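import Literature.Probability.LatticeModels.DobrushinMetricInfiniteRangeEstimate
import HarnessLib

/-!
# Dobrushin's comparison estimates in the Vasserstein form, infinite range with summable rows, VII:
two boundary conditions of one finite volume differing at ONE exterior site (the single-site boundary
influence of the kernels)

Sequel of `DobrushinMetricInfiniteRangeEstimate.lean`. For a specification `γ` whose one-site laws obey the global
Kantorovich–Rubinstein bound with SUMMABLE rows (`DobrushinMetricInfiniteRange.lean`), a finite volume `Λ`, an exterior site
`y ∉ Λ` and two boundary conditions `ω = η` off `y`, the kernels `γ_Λ(·|ω)`, `γ_Λ(·|η)` are both invariant under the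
one-site operators `γ_x`, `x ∈ Λ` (consistency), and the vector `R·𝟙_Λ + r(ω_y, η_y)·𝟙_{y}` is an estimate for the pair
on the global Lipschitz class (`abs_kernel_sub_kernel_le_tsum_indicator`; Föllmer 1988, Ch. I, (2.3), (2.22) for the
conditional specification (2.10)). The sweep of the previous file then gives

* `abs_kernel_sub_kernel_le_of_summable_superSolution` — for every bounded super-solution `d ≥ 0` on `Λ`
  (`∑' z, C x z d z ≤ d x`, `x ∈ Λ`) with `d y ≥ 1` and rows `≤ c < 1` on `Λ`:
  `|γ_Λ(f|ω) − γ_Λ(f|η)| ≤ r(ω_y, η_y) ∑_{z ∈ Δ_f} d z δ_f z` (Dobrushin 1970, Thm. 3; Föllmer 1988, (2.8)/(2.10): the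
  window coefficients of `γ_Λ` from the single-site ones, no finite set of neighbours);
* `abs_kernel_sub_kernel_le_of_summable_exp` — under the WEIGHTED rows `∑' z, C x z e^{t ρ(x,z)} ≤ c` (`ρ ≥ 0` a
  pseudo-metric: `ρ(x,y) ≤ ρ(x,z) + ρ(z,y)`, `ρ(y,y) = 0`) the profile `e^{−t ρ(·,y)}` is such a super-solution:
  `|γ_Λ(f|ω) − γ_Λ(f|η)| ≤ r(ω_y, η_y) ∑_{z ∈ Δ_f} e^{−t ρ(z,y)} δ_f z`, uniformly in `Λ ∌ y`.

This is the single-site boundary influence that feeds McDiarmid / Azuma concentration for the kernels and the Gibbs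
measures of infinite-range specifications. Theorems only: no definition, no named fact. The finite-range analogue is
`DobrushinComparisonBoundary.abs_kernel_sub_le_of_superSolution`.

## References

* R. L. Dobrushin, Theory Probab. Appl. 15 (1970) 458–486, Thm. 3.
* H. Föllmer, *Random fields and diffusion processes*, LNM 1362 (1988), Ch. I §2: (2.3), Lemma (2.5), Comparison Theorem
  (2.8), (2.10), Cor. (2.14), Remark (2.17), (2.22).
* H.-O. Georgii, *Gibbs Measures and Phase Transitions*, 2nd ed. (2011), Def. 1.23, Thm. 8.20, Remark 8.26.
-/

noncomputable section

open MeasureTheory ProbabilityTheory Finset Function Filter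
open scoped Topology

namespace Literature.Probability.LatticeModels

namespace DobrushinMetric

section KernelPair

variable {V S : Type*} [MeasurableSpace S] {γ : Specification V S} {r : S → S → ℝ} {C : V → V → ℝ}

/-- **The initial estimate for two boundary conditions differing at one exterior site, global Lipschitz class**
(Föllmer 1988, Ch. I, (2.3) and (2.22) for the conditional specification (2.10)): for `y ∉ Λ`, `ω = η` off `y`, and a
bounded measurable `F` with `|F σ − F τ| ≤ ∑' z, δ z · r(σ z, τ z)` (`δ ≥ 0` summable, `0 ≤ r ≤ R`, `r a a = 0`):
`|γ_Λ(F|ω) − γ_Λ(F|η)| ≤ ∑' z, (R 𝟙[z ∈ Λ] + r(ω_y, η_y) 𝟙[z = y]) δ z` — both kernels freeze the outside (properness),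
the two inside functions differ by `δ_y r(ω_y, η_y)` and each oscillates by at most `R ∑_{z ∈ Λ} δ z`.
[cite: Follmer1988, Ch. I (2.10)] -/
theorem abs_kernel_sub_kernel_le_tsum_indicator [DecidableEq V] (hγ : IsSpecification γ)
    {R : ℝ} (hr0 : ∀ a b, 0 ≤ r a b) (hrR : ∀ a b, r a b ≤ R) (hR : 0 ≤ R) (hr00 : ∀ a, r a a = 0)
    (Λ : Finset V) {y : V} (hy : y ∉ Λ) {ω η : V → S} (hωη : ∀ z, z ≠ y → ω z = η z)
    {F : (V → S) → ℝ} (hFm : Measurable F) {MF : ℝ} (hMF : ∀ σ, |F σ| ≤ MF)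
    {δ : V → ℝ} (hδ0 : ∀ y, 0 ≤ δ y) (hδs : Summable δ)
    (hδ : ∀ σ τ, |F σ - F τ| ≤ ∑' y, δ y * r (σ y) (τ y)) :
    |(∫ σ, F σ ∂(γ Λ ω)) - ∫ σ, F σ ∂(γ Λ η)| ≤
      ∑' z, ((if z ∈ Λ then R else 0) + if z = y then r (ω y) (η y) else 0) * δ z := by
  haveI := hγ.isProbability Λ ω
  haveI := hγ.isProbability Λ η
  -- inside versions of `F` with the outside frozen at `ξ`
  set glue : (V → S) → (V → S) → V → S := fun ξ σ z => if z ∈ Λ then σ z else ξ z with hglue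
  have hglm : ∀ ξ, Measurable (glue ξ) := fun ξ => by
    refine measurable_pi_iff.2 fun z => ?_
    by_cases hz : z ∈ Λ
    · simp only [hglue, if_pos hz]; exact measurable_pi_apply z
    · simp only [hglue, if_neg hz]; exact measurable_const
  set hω : (V → S) → ℝ := fun σ => F (glue ω σ) with hhω
  set hη : (V → S) → ℝ := fun σ => F (glue η σ) with hhη
  have hhωm : Measurable hω := hFm.comp (hglm ω)
  have hhηm : Measurable hη := hFm.comp (hglm η)
  have hhηB : ∀ σ, |hη σ| ≤ MF := fun σ => hMF _
  have hhωi : Integrable hω (γ Λ ω) := integrable_of_abs_le' hhωm fun σ => hMF _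
  have hhηiω : Integrable hη (γ Λ ω) := integrable_of_abs_le' hhηm hhηB
  have hhηiη : Integrable hη (γ Λ η) := integrable_of_abs_le' hhηm hhηB
  -- properness: `F = h_ξ` a.e. under `γ_Λ(·|ξ)`
  have hae : ∀ ξ : V → S, ∀ᵐ σ ∂(γ Λ ξ), F σ = F (glue ξ σ) := fun ξ => by
    filter_upwards [hγ.proper Λ ξ] with σ hσ
    congr 1; funext z
    by_cases hz : z ∈ Λ
    · simp only [hglue, if_pos hz]
    · simp only [hglue, if_neg hz]; exact hσ z hz
  have h1 : ∫ σ, F σ ∂(γ Λ ω) = ∫ σ, hω σ ∂(γ Λ ω) := integral_congr_ae (hae ω)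
  have h2 : ∫ σ, F σ ∂(γ Λ η) = ∫ σ, hη σ ∂(γ Λ η) := integral_congr_ae (hae η)
  -- the two inside functions differ by `δ_y r(ω_y, η_y)`
  have hdiff : ∀ σ, |hω σ - hη σ| ≤ δ y * r (ω y) (η y) := fun σ => by
    refine (hδ (glue ω σ) (glue η σ)).trans (le_of_eq ?_)
    rw [tsum_eq_single y (fun z hzy => ?_)]
    · simp only [hglue, if_neg hy]
    · by_cases hz : z ∈ Λ
      · simp only [hglue, if_pos hz, hr00, mul_zero]
      · simp only [hglue, if_neg hz, hωη z hzy, hr00, mul_zero]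
  -- the oscillation of `h_η`
  set K : ℝ := ∑' z, (if z ∈ Λ then R else 0) * δ z with hK
  have hsK : Summable fun z => (if z ∈ Λ then R else 0) * δ z :=
    Summable.of_nonneg_of_le (fun z => mul_nonneg (by split_ifs; exacts [hR, le_rfl]) (hδ0 z))
      (fun z => mul_le_mul_of_nonneg_right (by split_ifs; exacts [le_rfl, hR]) (hδ0 z)) (hδs.mul_left R)
  have hosc : ∀ σ τ, |hη σ - hη τ| ≤ K := by
    intro σ τ
    refine (hδ (glue η σ) (glue η τ)).trans ?_
    have hs : Summable fun z => δ z * r (glue η σ z) (glue η τ z) :=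
      Summable.of_nonneg_of_le (fun z => mul_nonneg (hδ0 z) (hr0 _ _))
        (fun z => mul_le_mul_of_nonneg_left (hrR _ _) (hδ0 z)) (hδs.mul_right R)
    refine hs.tsum_le_tsum (fun z => ?_) hsK
    by_cases hz : z ∈ Λ
    · rw [if_pos hz, mul_comm]
      exact mul_le_mul_of_nonneg_right (hrR _ _) (hδ0 z)
    · simp only [hglue, if_neg hz, hr00, mul_zero, zero_mul, le_refl]
  -- the two averages of `h_η` differ by at most `K`
  have hin : |(∫ σ, hη σ ∂(γ Λ ω)) - ∫ σ, hη σ ∂(γ Λ η)| ≤ K := by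
    have hup : ∀ τ, (∫ σ, hη σ ∂(γ Λ ω)) ≤ hη τ + K := fun τ =>
      calc ∫ σ, hη σ ∂(γ Λ ω) ≤ ∫ _σ, hη τ + K ∂(γ Λ ω) :=
            integral_mono hhηiω (integrable_const _) fun σ => by linarith [(abs_le.1 (hosc σ τ)).2]
        _ = hη τ + K := by simp
    have hdown : ∀ τ, hη τ - K ≤ ∫ σ, hη σ ∂(γ Λ ω) := fun τ =>
      calc hη τ - K = ∫ _σ, hη τ - K ∂(γ Λ ω) := by simp
        _ ≤ ∫ σ, hη σ ∂(γ Λ ω) :=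
            integral_mono (integrable_const _) hhηiω fun σ => by linarith [(abs_le.1 (hosc τ σ)).2]
    have hle : (∫ σ, hη σ ∂(γ Λ η)) ≤ (∫ σ, hη σ ∂(γ Λ ω)) + K :=
      calc ∫ σ, hη σ ∂(γ Λ η) ≤ ∫ _σ, (∫ σ, hη σ ∂(γ Λ ω)) + K ∂(γ Λ η) :=
            integral_mono hhηiη (integrable_const _) fun τ => by linarith [hdown τ]
        _ = (∫ σ, hη σ ∂(γ Λ ω)) + K := by simp
    have hge : (∫ σ, hη σ ∂(γ Λ ω)) - K ≤ ∫ σ, hη σ ∂(γ Λ η) :=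
      calc (∫ σ, hη σ ∂(γ Λ ω)) - K = ∫ _σ, (∫ σ, hη σ ∂(γ Λ ω)) - K ∂(γ Λ η) := by simp
        _ ≤ ∫ σ, hη σ ∂(γ Λ η) := integral_mono (integrable_const _) hhηiη fun τ => by linarith [hup τ]
    rw [abs_le]; constructor <;> linarith
  -- under `γ_Λ(·|ω)`: `|∫ h_ω − ∫ h_η| ≤ δ_y r(ω_y, η_y)`
  have hout : |(∫ σ, hω σ ∂(γ Λ ω)) - ∫ σ, hη σ ∂(γ Λ ω)| ≤ δ y * r (ω y) (η y) := by
    rw [← integral_sub hhωi hhηiω]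
    calc |∫ σ, (hω σ - hη σ) ∂(γ Λ ω)| ≤ ∫ σ, |hω σ - hη σ| ∂(γ Λ ω) := abs_integral_le_integral_abs
      _ ≤ ∫ _σ, δ y * r (ω y) (η y) ∂(γ Λ ω) :=
          integral_mono (hhωi.sub hhηiω).abs (integrable_const _) hdiff
      _ = δ y * r (ω y) (η y) := by simp
  -- assemble
  have hsy : Summable fun z => (if z = y then r (ω y) (η y) else 0) * δ z :=
    summable_of_ne_finset_zero (s := {y}) fun z hz => by
      rw [Finset.mem_singleton] at hz; rw [if_neg hz, zero_mul]
  have hsum : (∑' z, ((if z ∈ Λ then R else 0) + if z = y then r (ω y) (η y) else 0) * δ z) =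
      K + δ y * r (ω y) (η y) := by
    have h' : (∑' z, (if z = y then r (ω y) (η y) else 0) * δ z) = δ y * r (ω y) (η y) := by
      rw [tsum_eq_single y (fun z hz => by rw [if_neg hz, zero_mul]), if_pos rfl, mul_comm]
    rw [← h', ← hsK.tsum_add hsy]
    exact tsum_congr fun z => by ring
  rw [hsum, h1, h2]
  calc |(∫ σ, hω σ ∂(γ Λ ω)) - ∫ σ, hη σ ∂(γ Λ η)|
      ≤ |(∫ σ, hω σ ∂(γ Λ ω)) - ∫ σ, hη σ ∂(γ Λ ω)| + |(∫ σ, hη σ ∂(γ Λ ω)) - ∫ σ, hη σ ∂(γ Λ η)| :=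
        abs_sub_le _ _ _
    _ ≤ δ y * r (ω y) (η y) + K := add_le_add hout hin
    _ = K + δ y * r (ω y) (η y) := add_comm _ _

/-- **Dobrushin's comparison of two boundary conditions, window form, infinite range with summable rows** (Dobrushin 1970,
Thm. 3; Föllmer 1988, Ch. I, Comparison Theorem (2.8) for the conditional specification (2.10), run from the estimate
`R·𝟙_Λ + r(ω_y, η_y)·𝟙_{y}`): let the one-site laws of `γ` satisfy the global Kantorovich–Rubinstein bound with summable rows,
`Λ` a finite volume with rows `≤ c < 1`, `y ∉ Λ`, `ω = η` off `y`. Let `0 ≤ d ≤ B_d` with `1 ≤ d_y` be a super-solution on `Λ`: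
`∑' z, C x z · d z ≤ d x` for `x ∈ Λ`. Then for every bounded measurable `f` depending on `Δ` with coordinatewise
`r`-Lipschitz bound `δ`: `|∫ f dγ_Λ(·|ω) − ∫ f dγ_Λ(·|η)| ≤ r(ω_y, η_y) · ∑_{z ∈ Δ} d z δ z` — the window (block) Kantorovich
coefficients of `γ_Λ` from the single-site ones, no finite set of neighbours. [cite: Follmer1988, Ch. I Comparison Theorem (2.8)] -/
theorem abs_kernel_sub_kernel_le_of_summable_superSolution [DecidableEq V] (hγ : IsSpecification γ)
    {R : ℝ} (hr0 : ∀ a b, 0 ≤ r a b) (hrR : ∀ a b, r a b ≤ R) (hR : 0 ≤ R)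
    (hr00 : ∀ a, r a a = 0) (hC0 : ∀ x y, 0 ≤ C x y) (hCs : ∀ x, Summable (C x))
    (hcontr : ∀ (x : V) (ω η : V → S) (φ : S → ℝ) (L : ℝ), Measurable φ →
      (∃ M, ∀ s, |φ s| ≤ M) → 0 ≤ L → (∀ a b, |φ a - φ b| ≤ L * r a b) →
      |∫ s, φ s ∂(siteLaw γ x ω) - ∫ s, φ s ∂(siteLaw γ x η)| ≤
        L * ∑' y, C x y * r (ω y) (η y))
    (Λ : Finset V) {c : ℝ} (hc0 : 0 ≤ c) (hc1 : c < 1) (hrow : ∀ x ∈ Λ, ∑' z, C x z ≤ c)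
    {y : V} (hy : y ∉ Λ) {ω η : V → S} (hωη : ∀ z, z ≠ y → ω z = η z)
    {d : V → ℝ} (hd0 : ∀ z, 0 ≤ d z) {Bd : ℝ} (hdB : ∀ z, d z ≤ Bd) (hdy : 1 ≤ d y)
    (hsol : ∀ x ∈ Λ, ∑' z, C x z * d z ≤ d x)
    {f : (V → S) → ℝ} (hfm : Measurable f) {Δ : Finset V} (hfdep : DependsOn f (↑Δ : Set V))
    {Mf : ℝ} (hMf : ∀ σ, |f σ| ≤ Mf) {δ : V → ℝ} (hδ : IsLipBound r f δ) :
    |(∫ σ, f σ ∂(γ Λ ω)) - ∫ σ, f σ ∂(γ Λ η)| ≤ r (ω y) (η y) * ∑ z ∈ Δ, d z * δ z := by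
  classical
  haveI := hγ.isProbability Λ ω
  haveI := hγ.isProbability Λ η
  -- the two predicates of the abstract layer (Föllmer's class `L(Ω)`)
  set Adm : ((V → S) → ℝ) → Prop := fun F => Measurable F ∧ ∃ M, ∀ σ, |F σ| ≤ M with hAdmdef
  set Lip : ((V → S) → ℝ) → (V → ℝ) → Prop := fun F δ =>
    (∀ y, 0 ≤ δ y) ∧ Summable δ ∧ ∀ σ τ, |F σ - F τ| ≤ ∑' y, δ y * r (σ y) (τ y) with hLipdef
  have hlip0 : ∀ ⦃F : (V → S) → ℝ⦄ ⦃δ : V → ℝ⦄, Lip F δ → ∀ y, 0 ≤ δ y := fun F δ h => h.1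
  have hlips : ∀ ⦃F : (V → S) → ℝ⦄ ⦃δ : V → ℝ⦄, Lip F δ → Summable δ := fun F δ h => h.2.1
  have hT : ∀ ⦃F : (V → S) → ℝ⦄ (x : V), Adm F → Adm (siteAvg γ x F) := fun F x hF => by
    obtain ⟨hFm, M, hM⟩ := hF
    exact ⟨measurable_siteAvg hγ x hFm, M, fun σ => abs_siteAvg_le hγ x hM σ⟩
  have hdust : ∀ ⦃F : (V → S) → ℝ⦄ ⦃δ : V → ℝ⦄ (x : V), Adm F → Lip F δ →
      Lip (siteAvg γ x F) fun y => if y = x then 0 else δ y + C x y * δ x := fun F δ x hF h => by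
    obtain ⟨hFm, M, hM⟩ := hF
    obtain ⟨hδ0, hδs, hδ⟩ := h
    refine ⟨fun y => ?_, ?_, lip_siteAvg_tsum hγ hr0 hrR hr00 hC0 hCs hcontr x hFm hM hδ0 hδs hδ⟩
    · show 0 ≤ (if y = x then 0 else δ y + C x y * δ x)
      split_ifs
      · exact le_rfl
      · exact add_nonneg (hδ0 y) (mul_nonneg (hC0 x y) (hδ0 x))
    · exact Summable.of_nonneg_of_le
        (fun y => by
          split_ifs; exacts [le_rfl, add_nonneg (hδ0 y) (mul_nonneg (hC0 x y) (hδ0 x))])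
        (fun y => by
          split_ifs
          · exact add_nonneg (hδ0 y) (mul_nonneg (hC0 x y) (hδ0 x))
          · exact le_rfl)
        (hδs.add ((hCs x).mul_right (δ x)))
  -- both kernels are invariant under `γ_x`, `x ∈ Λ` (consistency)
  have hinv : ∀ (ξ : V → S) ⦃F : (V → S) → ℝ⦄ (x : V), x ∈ (↑Λ : Set V) → Adm F →
      ∫ σ, siteAvg γ x F σ ∂(γ Λ ξ) = ∫ σ, F σ ∂(γ Λ ξ) := fun ξ F x hx hF => by
    obtain ⟨hFm, M, hM⟩ := hF
    haveI := hγ.isProbability Λ ξ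
    exact hγ.integral_integral_consistent (Finset.singleton_subset_iff.2 (Finset.mem_coe.1 hx)) ξ
      (integrable_of_abs_le' hFm hM)
  -- the estimate
  have hry : 0 ≤ r (ω y) (η y) := hr0 _ _
  have ha : ∀ ⦃F : (V → S) → ℝ⦄ ⦃δ : V → ℝ⦄, Adm F → Lip F δ →
      |(∫ σ, F σ ∂(γ Λ ω)) - ∫ σ, F σ ∂(γ Λ η)| ≤
        ∑' z, ((if z ∈ Λ then R else 0) + if z = y then r (ω y) (η y) else 0) * δ z := fun F δ hF h => by
    obtain ⟨hFm, M, hM⟩ := hF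
    obtain ⟨hδ0, hδs, hδ'⟩ := h
    exact abs_kernel_sub_kernel_le_tsum_indicator hγ hr0 hrR hR hr00 Λ hy hωη hFm hM hδ0 hδs hδ'
  have ha0 : ∀ z, 0 ≤ (if z ∈ Λ then R else 0) + (if z = y then r (ω y) (η y) else 0) := fun z =>
    add_nonneg (by split_ifs; exacts [hR, le_rfl]) (by split_ifs; exacts [hry, le_rfl])
  have haB : ∀ z, (if z ∈ Λ then R else 0) + (if z = y then r (ω y) (η y) else 0) ≤ R + R := fun z =>
    add_le_add (by split_ifs; exacts [le_rfl, hR]) (by split_ifs; exacts [hrR _ _, hR])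
  -- the super-solution `r(ω_y, η_y) d`
  have hsol' : ∀ x ∈ (↑Λ : Set V), ∑' z, C x z * (r (ω y) (η y) * d z) ≤ r (ω y) (η y) * d x := fun x hx => by
    have h1 : ∑' z, C x z * (r (ω y) (η y) * d z) = r (ω y) (η y) * ∑' z, C x z * d z := by
      rw [← tsum_mul_left]; exact tsum_congr fun z => by ring
    rw [h1]
    exact mul_le_mul_of_nonneg_left (hsol x (Finset.mem_coe.1 hx)) hry
  have hinit : ∀ z, (if z ∈ Λ then R else 0) + (if z = y then r (ω y) (η y) else 0) ≤
      R * (↑Λ : Set V).indicator 1 z + r (ω y) (η y) * d z := fun z => by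
    by_cases hzΛ : z ∈ Λ
    · have hzy : z ≠ y := fun h' => hy (h' ▸ hzΛ)
      rw [if_pos hzΛ, if_neg hzy, add_zero, Set.indicator_of_mem (Finset.mem_coe.2 hzΛ), Pi.one_apply, mul_one]
      exact le_add_of_nonneg_right (mul_nonneg hry (hd0 z))
    · rw [if_neg hzΛ, zero_add, Set.indicator_of_notMem (fun h' => hzΛ (Finset.mem_coe.1 h')), mul_zero, zero_add]
      by_cases hzy : z = y
      · subst hzy; rw [if_pos rfl]
        exact le_mul_of_one_le_right hry hdy
      · rw [if_neg hzy]; exact mul_nonneg hry (hd0 z)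
  -- `f` is admissible with the global Lipschitz vector `δ 𝟙_{Δ}`
  have hF : Adm f := ⟨hfm, Mf, hMf⟩
  have hδ' : Lip f fun z => if z ∈ Δ then δ z else 0 := by
    refine ⟨fun z => ?_, summable_of_ne_finset_zero (s := Δ) fun z hz => if_neg hz,
      fun σ τ => abs_sub_le_tsum_of_dependsOn hfdep hδ σ τ⟩
    dsimp only
    split_ifs
    · exact hδ.nonneg z
    · exact le_rfl
  have key := abs_sub_le_tsum_of_superSolution_of_estimate (W := (↑Λ : Set V)) (T := fun x F => siteAvg γ x F)
    (E₁ := fun F => ∫ σ, F σ ∂(γ Λ ω)) (E₂ := fun F => ∫ σ, F σ ∂(γ Λ η))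
    hlip0 hlips hC0 hCs hT hdust (hinv ω) (hinv η) hc0 hc1 (fun x hx => hrow x (Finset.mem_coe.1 hx)) ha ha0 haB
    (astar := fun z => r (ω y) (η y) * d z) (fun z => mul_nonneg hry (hd0 z)) (Bs := R * Bd)
    (fun z => mul_le_mul (hrR _ _) (hdB z) (hd0 z) hR) hsol' hR hinit hF hδ'
  have hsum : (∑' z, r (ω y) (η y) * d z * (if z ∈ Δ then δ z else 0)) = r (ω y) (η y) * ∑ z ∈ Δ, d z * δ z := by
    rw [tsum_eq_sum (s := Δ) (fun z hz => by rw [if_neg hz, mul_zero]), Finset.mul_sum]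
    exact Finset.sum_congr rfl fun z hz => by rw [if_pos hz]; ring
  rw [← hsum]
  exact key

/-- **The exponential super-solution under the weighted row condition** (Föllmer 1988, Ch. I, Cor. (2.14); Georgii 2011,
Remark 8.26): if `ρ ≥ 0` satisfies `ρ(x,y) ≤ ρ(x,z) + ρ(z,y)` and `ρ(y,y) = 0`, `t ≥ 0`, and the WEIGHTED rows
`∑' z, C x z e^{t ρ(x,z)}` are summable with sum `≤ c ≤ 1` on `Λ`, then for `y ∉ Λ`, `ω = η` off `y` and every bounded
measurable local `f` with coordinatewise Lipschitz bound `δ`: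
`|∫ f dγ_Λ(·|ω) − ∫ f dγ_Λ(·|η)| ≤ r(ω_y, η_y) · ∑_{z ∈ Δ} e^{−t ρ(z,y)} δ z` — the influence of the boundary spin at `y` on
the kernel decays at the rate `t` of the Dobrushin weight, uniformly in the volume. [cite: Follmer1988, Ch. I Corollary (2.14)] -/
theorem abs_kernel_sub_kernel_le_of_summable_exp [DecidableEq V] (hγ : IsSpecification γ)
    {R : ℝ} (hr0 : ∀ a b, 0 ≤ r a b) (hrR : ∀ a b, r a b ≤ R) (hR : 0 ≤ R)
    (hr00 : ∀ a, r a a = 0) (hC0 : ∀ x y, 0 ≤ C x y) (hCs : ∀ x, Summable (C x))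
    (hcontr : ∀ (x : V) (ω η : V → S) (φ : S → ℝ) (L : ℝ), Measurable φ →
      (∃ M, ∀ s, |φ s| ≤ M) → 0 ≤ L → (∀ a b, |φ a - φ b| ≤ L * r a b) →
      |∫ s, φ s ∂(siteLaw γ x ω) - ∫ s, φ s ∂(siteLaw γ x η)| ≤
        L * ∑' y, C x y * r (ω y) (η y))
    (Λ : Finset V) {c : ℝ} (hc0 : 0 ≤ c) (hc1 : c < 1)
    (ρ : V → V → ℝ) (hρ0 : ∀ x z, 0 ≤ ρ x z) (hρself : ∀ x, ρ x x = 0)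
    (hρtri : ∀ x z w, ρ x w ≤ ρ x z + ρ z w) {t : ℝ} (ht : 0 ≤ t)
    (hsw : ∀ x ∈ Λ, Summable fun z => C x z * Real.exp (t * ρ x z))
    (hroww : ∀ x ∈ Λ, ∑' z, C x z * Real.exp (t * ρ x z) ≤ c)
    {y : V} (hy : y ∉ Λ) {ω η : V → S} (hωη : ∀ z, z ≠ y → ω z = η z)
    {f : (V → S) → ℝ} (hfm : Measurable f) {Δ : Finset V} (hfdep : DependsOn f (↑Δ : Set V))
    {Mf : ℝ} (hMf : ∀ σ, |f σ| ≤ Mf) {δ : V → ℝ} (hδ : IsLipBound r f δ) :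
    |(∫ σ, f σ ∂(γ Λ ω)) - ∫ σ, f σ ∂(γ Λ η)| ≤
      r (ω y) (η y) * ∑ z ∈ Δ, Real.exp (-(t * ρ z y)) * δ z := by
  have hd0 : ∀ z, 0 ≤ Real.exp (-(t * ρ z y)) := fun z => (Real.exp_pos _).le
  have hd1 : ∀ z, Real.exp (-(t * ρ z y)) ≤ 1 := fun z => Real.exp_le_one_iff.2 (by nlinarith [hρ0 z y])
  have hdy : (1 : ℝ) ≤ Real.exp (-(t * ρ y y)) := by rw [hρself]; simp
  have hsd : ∀ x, Summable fun z => C x z * Real.exp (-(t * ρ z y)) := fun x =>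
    Summable.of_nonneg_of_le (fun z => mul_nonneg (hC0 x z) (hd0 z))
      (fun z => by simpa using mul_le_mul_of_nonneg_left (hd1 z) (hC0 x z)) (hCs x)
  have hrow : ∀ x ∈ Λ, ∑' z, C x z ≤ c := fun x hx => by
    refine le_trans ((hCs x).tsum_le_tsum (fun z => ?_) (hsw x hx)) (hroww x hx)
    have h1 : (1 : ℝ) ≤ Real.exp (t * ρ x z) := Real.one_le_exp (mul_nonneg ht (hρ0 x z))
    simpa using mul_le_mul_of_nonneg_left h1 (hC0 x z)
  refine abs_kernel_sub_kernel_le_of_summable_superSolution hγ hr0 hrR hR hr00 hC0 hCs hcontr Λ hc0 hc1 hrow hy hωη hd0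
    hd1 hdy (fun x hx => ?_) hfm hfdep hMf hδ
  calc ∑' z, C x z * Real.exp (-(t * ρ z y))
      ≤ ∑' z, C x z * Real.exp (t * ρ x z) * Real.exp (-(t * ρ x y)) := by
        refine (hsd x).tsum_le_tsum (fun z => ?_) ((hsw x hx).mul_right _)
        rw [mul_assoc, ← Real.exp_add]
        refine mul_le_mul_of_nonneg_left (Real.exp_le_exp.2 ?_) (hC0 x z)
        nlinarith [hρtri x z y]
    _ = (∑' z, C x z * Real.exp (t * ρ x z)) * Real.exp (-(t * ρ x y)) := tsum_mul_right
    _ ≤ c * Real.exp (-(t * ρ x y)) := mul_le_mul_of_nonneg_right (hroww x hx) (Real.exp_pos _).le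
    _ ≤ Real.exp (-(t * ρ x y)) := by nlinarith [hd0 x, Real.exp_pos (-(t * ρ x y))]

end KernelPair

end DobrushinMetric

end Literature.Probability.LatticeModels

end
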